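import Mathlib
import Literature.NumberTheory.LFunctions.Zhang2022.TypedAppendixB
import Literature.NumberTheory.LFunctions.Zhang2022.AppendixBVarrhoU005
import HarnessLib

/-!
# Zhang (2022), Appendix B — the node `Z22:§B.u005` in its faithful two-constant reading, discharged

Topic `Literature/NumberTheory/LFunctions/Zhang2022` (Landau–Siegel audit tree; verdict-neutral).
Y. Zhang, *Discrete mean estimates and the Landau–Siegel zero*, arXiv:2211.02515v1 (2022)
[Zhang2022LandauSiegel] — an unrefereed manuscript under adjudication; nothing here asserts or denies
its Theorems 1–2.

The typed node `Typed.AppendixB.StepB_u005₂ c′` (`TypedAppendixB.lean`, section `ReadingU005`; DAG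
`Z22:§B.u005`, [Z22 p.107, tex L5275–5279]: "Thus the left side above is
`≤ (Σ_{q<D⁴}|ϱ_j(q)|/q)∏_{q<P}(1 + |ϱ_j(q)|/q + O(1/q²)) ≪ αΣ_{q<D⁴} log q/q`", with the two implied
constants kept distinct — gap row G-d59-2 of the cell's `plan/GAP-LEDGER.md`) is, verbatim, the
statement of the tree theorem `AppendixBVarrho.stepB_u005_two` (sz-d59, `AppendixBVarrhoU005.lean`:
`C₀ = 28`, `C = 3(1+5|c′|π)e^{12π(1+5|c′|π)+28}`). This file records the one-line bridge, so that the
node is closed by a `_holds` theorem of the typed declaration itself. Theorem-only; no new definitions,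
no new named facts.
-/

namespace Literature.NumberTheory.LFunctions.Zhang2022.Typed.AppendixB

/-- **`Z22:§B.u005` holds in the faithful two-constant reading**: `StepB_u005₂ c′` for every `c′`
(the display after (B.2), p.107: `Σ_{n<⌈P⌉,(n,𝔮)>1}|ϱ_j(n)|/n ≤ (Σ_{q<D⁴}|ϱ_j(q)|/q)∏_{q<⌈P⌉}(1 +
|ϱ_j(q)|/q + C₀/q²)` and `(…) ≤ C·α·Σ_{q<D⁴} log q/q`, `j ∈ {1,2,3}`, `D` large) — by
`AppendixBVarrho.stepB_u005_two`. [cite: Zhang2022LandauSiegel, App. B p.107 (display after (B.2))] -/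
theorem stepB_u005₂_holds (c' : ℝ) : StepB_u005₂ c' :=
  AppendixBVarrho.stepB_u005_two c'

variable (c' : ℝ) in
/-- `StepB_u005₂` — `_holds` alias of `stepB_u005₂_holds` above under the fact's exact name, stated under the
prover's own binders as section variables (appended 2026-08-28, D-0026 bookkeeping: the proof term is the
existing theorem of this file; no statement, definition or attribute is edited; no new named fact; the
ledger's debt table listed the fact unproved). [cite: Zhang2022LandauSiegel, App. B p.107 (display after (B.2))] -/
theorem _root_.Literature.NumberTheory.LFunctions.Zhang2022.Typed.AppendixB.StepB_u005₂_holds :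
    _root_.Literature.NumberTheory.LFunctions.Zhang2022.Typed.AppendixB.StepB_u005₂ c' :=
  _root_.Literature.NumberTheory.LFunctions.Zhang2022.Typed.AppendixB.stepB_u005₂_holds (c' := c')

end Literature.NumberTheory.LFunctions.Zhang2022.Typed.AppendixB
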